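import Summits.BirchSwinnertonDyer.Rank1Residual.Additive.GoodModelKernelH1OfDeeplyRamified
import Literature.NumberTheory.EllipticCurves.CoatesGreenberg1996.CyclotomicZpExtensionDeeplyRamified
import HarnessLib

/-!
# K4 `SignedControlAtTwo` (stmt-BirchSwinnertonDyer-20309) / `PublishedInputsGreenbergControlAtTwo`
# (stmt-24143, conj. 5): the printed input (I2) — Coates–Greenberg Cor. 3.2 — from ONE field

D-0154 (2) INPUTS, row 1, input (I2) `WeierstrassCurve.CoatesGreenberg1996_H1_formalGroup_trivial`
(Coates–Greenberg, Invent. Math. 124 (1996) Cor. 3.2 with Thm. 2.13, as quoted by Greenberg LNM 1716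
p. 83: `H¹(K_v K_∞, 𝓕(𝔪̄)) = 0`), the `h2` of Greenberg's Thm. 1.7 at a supersingular prime
(`WeierstrassCurve.SelmerDualData.not_isTorsion_of_supersingular_holds_of`), which feeds
`h1SigmaInfty_rank_eq_one_of_corank_of_notTorsion` (sibling `…SignedControlAtTwoH1SigmaRankOne`) and so
conj. 5 `Greenberg1999.h1SigmaInfty_rank_eq_one` of `PublishedInputsGreenbergControlAtTwo`.

READ-BACK of the tree (2026-08-28): (I2) is already DERIVED —
(I2) ⇐ `CoatesGreenberg1996.H1_goodModelKernel_trivial` (`…_of_goodModelKernel`)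
⇐ `CoatesGreenberg1996.deeplyRamified_cyclotomic_trace` =: DR
(`CoatesGreenberg1996_H1_formalGroup_trivial_of_deeplyRamifiedTrace`, Summits
`Rank1Residual/Additive/GoodModelKernelH1OfDeeplyRamified`), DR = [CoGr] §2 p. 143 (iii) / Thm. 2.13 for
EVERY field between `K_v K_∞^{cyc}` and `K̄_v`. The new Literature file
`CoatesGreenberg1996/CyclotomicZpExtensionDeeplyRamified` proves DR EQUIVALENT to its one-field base
instance `CoatesGreenberg1996.deeplyRamified_cyclotomicZpExtension_trace` =: (B) («the cyclotomic
`ℤ_p`-extension `K_v K_∞` of `K_v` is deeply ramified», Greenberg LNM 1716 p. 84 + Iovita–Zaharescu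
1999 Thm. 1.2 (iii)). THIS FILE records the consequences for the row-1 binder, THEOREMS ONLY:

* `H1_goodModelKernel_trivial_of_cyclotomicZpExtension : (B) → H1_goodModelKernel_trivial`;
* `CoatesGreenberg1996_H1_formalGroup_trivial_of_cyclotomicZpExtension : (B) → (I2)`;
* `not_isTorsion_of_supersingular_of_cyclotomicZpExtension : (B) → (I1) → Thm. 1.7` (Greenberg
  LNM 1716 Thm. 1.7 at a supersingular prime, for every Selmer dual datum).

HONEST FRAMING: (I2) stays CONDITIONAL — on (B) instead of DR; (B) (= Tate 1967 §3.2 / [CoGr]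
Thm. 2.13 for the single field `K_v K_∞^{cyc}`) is NOT proved in the tree (higher ramification theory
— Herbrand's upper numbering, differents in `ℤ_p`-towers — is in neither Mathlib nor the tree). No
item is closed by this file; BSD is not proved by any of this.

References: [CoatesGreenberg1996] Cor. 3.2, Thm. 2.13, §2 p. 143; [GreenbergLNM1716] Thm. 1.7
(pp. 61–62), §2 pp. 83–84; [IovitaZaharescu1999] Thm. 1.2 (iii); [Tate1967] §3.1–3.2.
-/

set_option autoImplicit false
-- the Theorems namespace of this sub repeats the summit name by design (D-0017 nested layout)
set_option linter.dupNamespace false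

noncomputable section

open Literature.NumberTheory.EllipticCurves Literature.NumberTheory.EllipticCurves.CoatesGreenberg1996

universe u

namespace Summit.BirchSwinnertonDyer.BirchSwinnertonDyer.Theorems

/-- **[CoGr] Cor. 3.2 for good models from ONE field.** The Coates–Greenberg record
`H1_goodModelKernel_trivial` (`H¹(L, Ŵ₀(𝔪̄)) = 0` for a good model and every closed
`G_L ≤ (ker κ)_v` fixing the model) follows from the one-field base instance
`deeplyRamified_cyclotomicZpExtension_trace` («`K_v K_∞^{cyc}` is deeply ramified», Greenberg LNM 1716
p. 84), through `deeplyRamified_cyclotomic_trace_of_cyclotomicZpExtension` and the almost-étale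
successive approximation `H1_goodModelKernel_trivial_of_deeplyRamifiedTrace`.
[cite: CoatesGreenberg1996, Cor. 3.2 with Thm. 2.13 (through GreenbergLNM1716 pp. 83–84)] -/
theorem H1_goodModelKernel_trivial_of_cyclotomicZpExtension
    (hB : deeplyRamified_cyclotomicZpExtension_trace.{u}) : H1_goodModelKernel_trivial.{u} :=
  H1_goodModelKernel_trivial_of_deeplyRamifiedTrace
    (deeplyRamified_cyclotomic_trace_of_cyclotomicZpExtension hB)

/-- **(I2) from ONE field.** Greenberg's input at a supersingular prime,
`WeierstrassCurve.CoatesGreenberg1996_H1_formalGroup_trivial` (`H¹(K_v K_∞, 𝓕(𝔪̄)) = 0`, [CoGr]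
Cor. 3.2 as quoted in LNM 1716 p. 83), follows from the one-field base instance
`deeplyRamified_cyclotomicZpExtension_trace` (LNM 1716 p. 84: «a ramified `ℤ_p`-extension `K` of
`F_v` is the simplest example of a deeply ramified extension», trace form). So the row-1 binder may
display (B) in place of (I2)/DR: one field `K_v K_∞^{cyc}` per `(K, v, p)`.
[cite: GreenbergLNM1716, §2 p. 83 ("special case of Corollary 3.2 in [CoGr]") and p. 84]
[cite: CoatesGreenberg1996, Cor. 3.2 with Thm. 2.13] -/
theorem CoatesGreenberg1996_H1_formalGroup_trivial_of_cyclotomicZpExtension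
    (hB : deeplyRamified_cyclotomicZpExtension_trace.{u}) :
    WeierstrassCurve.CoatesGreenberg1996_H1_formalGroup_trivial.{u} :=
  WeierstrassCurve.CoatesGreenberg1996_H1_formalGroup_trivial_of_deeplyRamifiedTrace
    (deeplyRamified_cyclotomic_trace_of_cyclotomicZpExtension hB)

/-- **Greenberg's Thm. 1.7 (supersingular case) from (B) and (I1).** For every Selmer dual datum
`D` of `E/K` along a `ℤ_p`-extension: `X(E/K_∞)` is not `Λ`-torsion at a prime of good supersingular
reduction above `p` (`D.not_isTorsion_of_supersingular`), GIVEN the one-field base instance (B)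
`deeplyRamified_cyclotomicZpExtension_trace` (in place of (I2)) and the relaxed finite-level Selmer
count (I1) `relaxedSelmer_torsion_card_growth` — the assembly
`SelmerDualData.not_isTorsion_of_supersingular_holds_of` with (I2) supplied by
`CoatesGreenberg1996_H1_formalGroup_trivial_of_cyclotomicZpExtension`. This is the `hNT` consumed by
`h1SigmaInfty_rank_eq_one_of_corank_of_notTorsion` (K4 door; conj. 5 of
`PublishedInputsGreenbergControlAtTwo`). [cite: GreenbergLNM1716, Thm 1.7 (pp. 61–62) and §2 (p. 84)] -/
theorem not_isTorsion_of_supersingular_of_cyclotomicZpExtension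
    {K : Type u} [Field K] [NumberField K] {W : WeierstrassCurve K} {p : ℕ} [Fact p.Prime]
    {κ : ZpExtension K p} {γ : Field.absoluteGaloisGroup K} (D : WeierstrassCurve.SelmerDualData W κ γ)
    (hB : deeplyRamified_cyclotomicZpExtension_trace.{u})
    (h1 : WeierstrassCurve.relaxedSelmer_torsion_card_growth.{u}) :
    D.not_isTorsion_of_supersingular :=
  D.not_isTorsion_of_supersingular_holds_of
    (CoatesGreenberg1996_H1_formalGroup_trivial_of_cyclotomicZpExtension hB) h1

end Summit.BirchSwinnertonDyer.BirchSwinnertonDyer.Theorems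

end
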